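import Literature.Analysis.Matrix.LogDetMixedDifferenceLocallySummedIcc
import HarnessLib

/-!
# S2β · LINE g18-1 · DET-REP-B — THE TRACE-DIFFERENCE DOOR: `Δ² log det` from ONE row on Jacobi's integrand (cancellation allowed), and the old letters imply it

Cell `ym3-torus` (rung R3: continuum `SU(2)` Yang–Mills on `T³` — NOT `d = 4`, NOT infinite volume, NOT a mass gap, NOT Clay); width seat
`ym-ust-20520-w5` g15; helper of the crux `stmt-QuantumFields-20520` (`--supports … --as helper`, NOT a proof of it).  Companion of
✓`…FluctuationComparisonRegPrIntLS2BetaProductRowsTightness` (p754335) and of the memo `ym-ust-20520-w5/g15/FINDING-w5g15-DETREPB-DEPTH.md` (20520 evidence #50):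
there the (LOC) block `ProductRows` of DET-REP-B (`Cruxes/FluctuationComparisonRegPrIntL/Lines/semiclassical_s2beta.lean` v11∕v11.1∕v11.2, l.822) was shown to
force EXTENSIVE-by-INTENSIVE bounds on the named slice Hessians, because ✓`Literature.Analysis.Matrix.abs_fourPt_log_det_le_of_productRows_of_subset` bounds the
two halves of Jacobi's integrand («tadpole» `tr(M⁻¹∂²M)` and «bubble» `tr(M⁻¹∂M M⁻¹∂M)`) SEPARATELY in absolute value — each UV-linearly divergent in `d = 3`,
finite only together.  Repair (R-b) of the memo: bind the INTEGRAND DIFFERENCE, not its halves.  This file is the door for that repair: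

* §1 ★★`abs_fourPt_log_det_le_of_traceDiff_Icc` — a two-parameter family `M(s,t)` (`t = 0,1`) entrywise continuous on `s ∈ [0,1]`, differentiable on `(0,1)` with
  derivative `M′(s,t)` continuous on `[0,1]`, invertible on `[0,1]`, and ONE ROW
  `hT : ∀ s ∈ [0,1], |tr(M(s,1)⁻¹ M′(s,1)) − tr(M(s,0)⁻¹ M′(s,0))| ≤ T` ⟹ `|log det M(0,0) − log det M(1,0) − (log det M(0,1) − log det M(1,1))| ≤ T`
  (FTC ✓`log_det_sub_eq_integral_trace_Icc` on both edges, `∫₀¹` of a function bounded by `T`).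
* §2 ★★`abs_fourPt_log_det_le_of_traceDiff_of_subset` — docking edition with the differentiability ∕ continuity ∕ invertibility rows on any `I ⊇ [0,1]`: EXACTLY the
  binders `hI hM hM'c hne` that `fourPtDecay_of_detRep` (line file §4c) already builds for ✓`…_productRows_of_subset`, the ten localisation letters
  `hα hε hδ hβ₀ hθ₂ hθ₂θ hSdist0 hD hE hsep hA hB0 hSd hSdi hR hprod hmix` REPLACED by `hT`.  A v12 `DetRepB′ := TubeRows ∧ … ∧ EdgeRows ×2 ∧ TRACE-DIFF ∧ (JAC)` with
  TRACE-DIFF `∀ s ∈ Icc 0 1, |tr((M₁ s)⁻¹ M₁′ s) − tr((M₀ s)⁻¹ M₀′ s)| ≤ 2·Cst·θBal_J²·e^{−(θ−θ₂)R}` on the NAMED `M_t := hessStd (A ∘ c.Φ(x_t ·, σ ·)) y_t` keeps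
  RULING W3's regression object (operators bound, no free amplitude) and swaps ONE `have rect := …` in the composition; the downstream arithmetic
  (`½·(2·B·e)`) is byte-stable.
* §3 ★`traceDiff_le_of_summedProfiles` ∕ ★`traceDiff_le_of_productRows` — the OLD letters imply the NEW row POINTWISE: `ProductRows`' rows at `s` ⟹
  `|tr(M₁⁻¹M₁′) − tr(M₀⁻¹M₀′)| ≤ α·ε·β₀·δ·Sd·Sdist·e^{−(θ−θ₂)R} + β₀·η ≤ 2·B·e^{−(θ−θ₂)R}` (✓`trace_inv_mul_sub_trace_inv_mul` + ✓`abs_trace_mul4_le_of_summedProfiles` +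
  ✓`abs_trace_mul_le_of_entry_le_of_sum_le`) — so the re-lettered organ is IMPLIED BY the old one (no content added; only the depth-divergent excess removed);
  composing §3 with §2 re-derives ✓`…_productRows_of_subset`'s conclusion (kept out of this file: it would restate that theorem — dedup).

HONEST SCOPE.  Finite-dimensional linear algebra + FTC on `[0,1]` (px19's kit); def-free; default heartbeats; proves nothing of DET-REP-B ∕ FOUR-POINT-DECAY ∕ S2β ∕ the crux
20520; whether TRACE-DIFF holds depth-uniformly for the named matrices is the ORGAN's content ([Balaban1985Variational] Thm 1 (9)–(10), [Balaban1985UV3] (36)–(37): the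
one-loop determinant's background dependence with its local counterterms), NOT claimed here; `YM3TorusSU2` NOT proved; the Yang–Mills mass gap (Clay) NOT proved.
References: [Balaban1985Variational] CMP 102 (1985) 277, Thm 1 (9)–(10) p. 279; [Balaban1985UV3] CMP 102 (1985) 255, (36)–(37) p. 265; [HornJohnson2013] §0.7.4,
§0.8.10, §5.6; [GlimmJaffe1987] §18.2.
-/

noncomputable section

open Matrix Finset MeasureTheory intervalIntegral Set Literature.Analysis.Matrix
open scoped Matrix Topology

namespace Summit.QuantumFields.YangMills.Theorems.FluctuationComparisonRegPrIntLS2BetaLogDetTraceDiffDoor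

variable {n : Type*} [Fintype n] [DecidableEq n]

/-! ## §1 The door on `[0,1]` -/

/-- Jacobi's integrand `s ↦ tr(M(s)⁻¹ M′(s))` is continuous on `[0,1]` when the entries of `M`, `M′` are and `det M ≠ 0` there. [cite: HornJohnson2013, §0.8.10] -/
theorem continuousOn_trace_inv_mul {M M' : ℝ → Matrix n n ℝ}
    (hMc : ∀ i j, ContinuousOn (fun s => M s i j) (Icc 0 1)) (hM'c : ∀ i j, ContinuousOn (fun s => M' s i j) (Icc 0 1))
    (hne : ∀ s ∈ Icc (0 : ℝ) 1, (M s).det ≠ 0) :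
    ContinuousOn (fun s => ((M s)⁻¹ * M' s).trace) (Icc 0 1) := by
  have hMco : ContinuousOn M (Icc 0 1) := continuousOn_pi.2 fun i => continuousOn_pi.2 fun j => hMc i j
  have hM'co : ContinuousOn M' (Icc 0 1) := continuousOn_pi.2 fun i => continuousOn_pi.2 fun j => hM'c i j
  have hinv : ContinuousOn (fun s => (M s)⁻¹) (Icc 0 1) := by
    intro s hs
    have h : ContinuousAt Ring.inverse (M s).det := by
      rw [Ring.inverse_eq_inv']
      exact continuousAt_inv₀ (hne s hs)
    exact ContinuousAt.comp_continuousWithinAt (f := M) (g := fun A : Matrix n n ℝ => A⁻¹) (continuousAt_matrix_inv (M s) h) (hMco s hs)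
  exact (continuous_id.matrix_trace.comp_continuousOn (hinv.mul hM'co) :)

/-- ★★ **THE TRACE-DIFFERENCE DOOR (local-in-`s` hypotheses).**  For a two-parameter family `M(s,t)` of real matrices, `t ∈ {0,1}` the two edges: if every entry
`s ↦ M(s,t) i j` is continuous on `[0,1]` with derivative `M′(s,t) i j` on `(0,1)`, `s ↦ M′(s,t) i j` continuous on `[0,1]`, `det M(s,t) ≠ 0` on `[0,1]`, and the
DIFFERENCE OF JACOBI's INTEGRANDS satisfies `|tr(M(s,1)⁻¹ M′(s,1)) − tr(M(s,0)⁻¹ M′(s,0))| ≤ T` on `[0,1]`, then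
`|log det M(0,0) − log det M(1,0) − (log det M(0,1) − log det M(1,1))| ≤ T`.  (Both halves of the integrand may be individually large; only their difference is
bound.) [cite: HornJohnson2013, §0.8.10 (Jacobi's formula)] [cite: Balaban1985Variational, Thm 1 (9)-(10) p. 279] -/
theorem abs_fourPt_log_det_le_of_traceDiff_Icc {M M' : ℝ → ℝ → Matrix n n ℝ}
    (hMc : ∀ t i j, ContinuousOn (fun s => M s t i j) (Icc 0 1))
    (hM : ∀ t, ∀ s ∈ Ioo (0 : ℝ) 1, ∀ i j, HasDerivAt (fun s => M s t i j) (M' s t i j) s)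
    (hM'c : ∀ t i j, ContinuousOn (fun s => M' s t i j) (Icc 0 1))
    (hne : ∀ s ∈ Icc (0 : ℝ) 1, ∀ t, (M s t).det ≠ 0)
    {T : ℝ} (hT : ∀ s ∈ Icc (0 : ℝ) 1, |((M s 1)⁻¹ * M' s 1).trace - ((M s 0)⁻¹ * M' s 0).trace| ≤ T) :
    |Real.log (M 0 0).det - Real.log (M 1 0).det - (Real.log (M 0 1).det - Real.log (M 1 1).det)| ≤ T := by
  -- FTC on both edges
  have hF : ∀ t, Real.log (M 1 t).det - Real.log (M 0 t).det = ∫ s in (0 : ℝ)..1, ((M s t)⁻¹ * M' s t).trace := fun t =>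
    log_det_sub_eq_integral_trace_Icc (M := fun s => M s t) (M' := fun s => M' s t) (hMc t) (hM t) (hM'c t) (fun s hs => hne s hs t)
  have hcont : ∀ t, ContinuousOn (fun s => ((M s t)⁻¹ * M' s t).trace) (Icc 0 1) := fun t =>
    continuousOn_trace_inv_mul (M := fun s => M s t) (M' := fun s => M' s t) (hMc t) (hM'c t) (fun s hs => hne s hs t)
  have hint : ∀ t, IntervalIntegrable (fun s => ((M s t)⁻¹ * M' s t).trace) volume 0 1 := fun t =>
    ContinuousOn.intervalIntegrable (by rw [Set.uIcc_of_le (zero_le_one : (0 : ℝ) ≤ 1)]; exact hcont t)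
  have hrw : Real.log (M 0 0).det - Real.log (M 1 0).det - (Real.log (M 0 1).det - Real.log (M 1 1).det)
      = ∫ s in (0 : ℝ)..1, (((M s 1)⁻¹ * M' s 1).trace - ((M s 0)⁻¹ * M' s 0).trace) := by
    rw [intervalIntegral.integral_sub (hint 1) (hint 0), ← hF 1, ← hF 0]; ring
  rw [hrw]
  have hb : ∀ s ∈ Set.uIoc (0 : ℝ) 1, ‖((M s 1)⁻¹ * M' s 1).trace - ((M s 0)⁻¹ * M' s 0).trace‖ ≤ T := by
    intro s hs
    rw [Set.uIoc_of_le (zero_le_one : (0 : ℝ) ≤ 1)] at hs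
    rw [Real.norm_eq_abs]
    exact hT s (Ioc_subset_Icc_self hs)
  have h := intervalIntegral.norm_integral_le_of_norm_le_const hb
  rw [Real.norm_eq_abs] at h
  simpa using h

/-! ## §2 Docking edition: rows on a set `I ⊇ [0,1]` (the binders the line's composition already builds) -/

/-- ★★ **THE TRACE-DIFFERENCE DOOR, DOCKING EDITION.**  Same conclusion from: entrywise derivatives `M′(s,t)` at every `s ∈ I ⊇ [0,1]`, `s ↦ M′(s,t) i j` continuous
on `I`, `det M(s,t) ≠ 0` on `I` (EXACTLY the binders `hI hM hM'c hne` of ✓`abs_fourPt_log_det_le_of_productRows_of_subset`), and the trace-difference row on `[0,1]`.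
In DET-REP-B′: `M s 0 := hessStd (A ∘ c.Φ(x₀ ·, σ ·)) y₀ s`, `M s 1 := … x₁ … y₁ …`, `T := 2·Cst·θBal_J²·e^{−(θ−θ₂)·tdist_J(b,b′)}`.
[cite: HornJohnson2013, §0.8.10] [cite: Balaban1985Variational, Thm 1 (9)-(10) p. 279] [cite: Balaban1985UV3, (36)-(37) p. 265] -/
theorem abs_fourPt_log_det_le_of_traceDiff_of_subset {M M' : ℝ → ℝ → Matrix n n ℝ} {I : Set ℝ} (hI : Icc (0 : ℝ) 1 ⊆ I)
    (hM : ∀ t, ∀ s ∈ I, ∀ i j, HasDerivAt (fun s => M s t i j) (M' s t i j) s)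
    (hM'c : ∀ t i j, ContinuousOn (fun s => M' s t i j) I)
    (hne : ∀ s ∈ I, ∀ t, (M s t).det ≠ 0)
    {T : ℝ} (hT : ∀ s ∈ Icc (0 : ℝ) 1, |((M s 1)⁻¹ * M' s 1).trace - ((M s 0)⁻¹ * M' s 0).trace| ≤ T) :
    |Real.log (M 0 0).det - Real.log (M 1 0).det - (Real.log (M 0 1).det - Real.log (M 1 1).det)| ≤ T := by
  have hMc : ∀ t i j, ContinuousOn (fun s => M s t i j) (Icc 0 1) := fun t i j s hs =>
    ((hM t s (hI hs) i j).continuousAt).continuousWithinAt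
  exact abs_fourPt_log_det_le_of_traceDiff_Icc hMc (fun t s hs i j => hM t s (hI (Ioo_subset_Icc_self hs)) i j)
    (fun t i j => (hM'c t i j).mono hI) (fun s hs t => hne s (hI hs) t) hT

/-! ## §3 The old letters imply the new row (DET-REP-B′ ⟸ DET-REP-B pointwise) -/

/-- ★ **THE LOCALISATION LETTERS BOUND THE TRACE DIFFERENCE POINTWISE.**  For four real matrices `M₀ M₁` (invertible) and `M₀′ M₁′`: the rows `hD hE hA hB0 hR` of
✓`abs_fourPt_log_det_le_of_summedProfiles` at ONE parameter value, with the local sums `hSd hSdi` and the separation `hsep`, give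
`|tr(M₁⁻¹M₁′) − tr(M₀⁻¹M₀′)| ≤ α·ε·β₀·δ·Sd·Sdist·e^{−(θ−θ₂)R} + β₀·η` — via ✓`trace_inv_mul_sub_trace_inv_mul` (`= −tr(M₁⁻¹(M₁−M₀)M₀⁻¹M₁′) + tr(M₀⁻¹(M₁′−M₀′))`),
✓`abs_trace_mul4_le_of_summedProfiles` and ✓`abs_trace_mul_le_of_entry_le_of_sum_le`. [cite: HornJohnson2013, §0.7.4 and §5.6] [cite: GlimmJaffe1987, §18.2] -/
theorem traceDiff_le_of_summedProfiles (dist : n → n → ℕ) {M₀ M₁ M₀' M₁' : Matrix n n ℝ} (h₀ : M₀.det ≠ 0) (h₁ : M₁.det ≠ 0)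
    {α ε δ β₀ η θ θ₂ Sd Sdist : ℝ} (hα : 0 ≤ α) (hε : 0 ≤ ε) (hδ : 0 ≤ δ) (hβ₀ : 0 ≤ β₀)
    (hθ₂ : 0 ≤ θ₂) (hθ₂θ : θ₂ ≤ θ) (hSdist0 : 0 ≤ Sdist)
    {d d' : n → ℕ} (hD : ∀ a, ∑ x, |M₁' x a| ≤ δ * Real.exp (-(θ * d a)))
    (hE : ∀ b, ∑ c, |(M₁ - M₀) b c| ≤ ε * Real.exp (-(θ * d' b)))
    {R : ℕ} (hsep : ∀ a b, R ≤ d a + dist a b + d' b)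
    (hA : ∀ a b, |M₁⁻¹ a b| ≤ α * Real.exp (-(θ * dist a b)))
    (hB0 : ∀ a b, |M₀⁻¹ a b| ≤ β₀)
    (hSd : ∑ a, Real.exp (-(θ₂ * d a)) ≤ Sd) (hSdi : ∀ a, ∑ b, Real.exp (-(θ₂ * dist a b)) ≤ Sdist)
    (hR : ∑ a, ∑ b, |(M₁' - M₀') a b| ≤ η) :
    |(M₁⁻¹ * M₁').trace - (M₀⁻¹ * M₀').trace| ≤ α * ε * β₀ * δ * Sd * Sdist * Real.exp (-((θ - θ₂) * R)) + β₀ * η := by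
  rw [trace_inv_mul_sub_trace_inv_mul h₀ h₁]
  have h4 : |(M₁⁻¹ * (M₁ - M₀) * M₀⁻¹ * M₁').trace| ≤ α * ε * β₀ * δ * Sd * Sdist * Real.exp (-((θ - θ₂) * R)) :=
    abs_trace_mul4_le_of_summedProfiles dist hα hε hβ₀ hδ hθ₂ hθ₂θ hSdist0 hA hB0 hD hE hsep hSd hSdi
  have h2 : |(M₀⁻¹ * (M₁' - M₀')).trace| ≤ β₀ * η := abs_trace_mul_le_of_entry_le_of_sum_le hβ₀ hB0 hR
  calc |-(M₁⁻¹ * (M₁ - M₀) * M₀⁻¹ * M₁').trace + (M₀⁻¹ * (M₁' - M₀')).trace|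
      ≤ |-(M₁⁻¹ * (M₁ - M₀) * M₀⁻¹ * M₁').trace| + |(M₀⁻¹ * (M₁' - M₀')).trace| := abs_add_le _ _
    _ ≤ α * ε * β₀ * δ * Sd * Sdist * Real.exp (-((θ - θ₂) * R)) + β₀ * η := by rw [abs_neg]; exact add_le_add h4 h2

/-- ★ **`ProductRows`' LETTERS IMPLY THE TRACE-DIFFERENCE ROW** (`T := 2·B·e^{−(θ−θ₂)R}`), pointwise on `[0,1]`: the rows of the line's `ProductRows M₀ M₁ M₀′ M₁′ …`
(families `ℝ → Matrix`, hypotheses on `s ∈ [0,1]`) + `α·ε·β₀·δ·Sd·Sdist ≤ B`, `β₀·η ≤ B·e^{−(θ−θ₂)R}` ⟹ at every `s ∈ [0,1]` where both matrices are invertible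
`|tr((M₁ s)⁻¹ M₁′ s) − tr((M₀ s)⁻¹ M₀′ s)| ≤ 2·B·e^{−(θ−θ₂)R}`.  So DET-REP-B′ (TRACE-DIFF) is IMPLIED BY DET-REP-B (LOC): a re-lettering that removes hypotheses only.
[cite: HornJohnson2013, §0.7.4 and §5.6] [cite: GlimmJaffe1987, §18.2] [cite: Balaban1985Variational, Thm 1 (9)-(10) p. 279] -/
theorem traceDiff_le_of_productRows (dist : n → n → ℕ) {M₀ M₁ M₀' M₁' : ℝ → Matrix n n ℝ}
    {α ε δ β₀ η θ θ₂ Sd Sdist B : ℝ} (hα : 0 ≤ α) (hε : 0 ≤ ε) (hδ : 0 ≤ δ) (hβ₀ : 0 ≤ β₀)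
    (hθ₂ : 0 ≤ θ₂) (hθ₂θ : θ₂ ≤ θ) (hSdist0 : 0 ≤ Sdist)
    {d d' : n → ℕ} (hD : ∀ s ∈ Icc (0 : ℝ) 1, ∀ a, ∑ x, |M₁' s x a| ≤ δ * Real.exp (-(θ * d a)))
    (hE : ∀ s ∈ Icc (0 : ℝ) 1, ∀ b, ∑ c, |(M₁ s - M₀ s) b c| ≤ ε * Real.exp (-(θ * d' b)))
    {R : ℕ} (hsep : ∀ a b, R ≤ d a + dist a b + d' b)
    (hA : ∀ s ∈ Icc (0 : ℝ) 1, ∀ a b, |(M₁ s)⁻¹ a b| ≤ α * Real.exp (-(θ * dist a b)))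
    (hB0 : ∀ s ∈ Icc (0 : ℝ) 1, ∀ a b, |(M₀ s)⁻¹ a b| ≤ β₀)
    (hSd : ∑ a, Real.exp (-(θ₂ * d a)) ≤ Sd) (hSdi : ∀ a, ∑ b, Real.exp (-(θ₂ * dist a b)) ≤ Sdist)
    (hR : ∀ s ∈ Icc (0 : ℝ) 1, ∑ a, ∑ b, |(M₁' s - M₀' s) a b| ≤ η)
    (hprod : α * ε * β₀ * δ * Sd * Sdist ≤ B) (hmix : β₀ * η ≤ B * Real.exp (-((θ - θ₂) * R)))
    {s : ℝ} (hs : s ∈ Icc (0 : ℝ) 1) (h₀ : (M₀ s).det ≠ 0) (h₁ : (M₁ s).det ≠ 0) :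
    |((M₁ s)⁻¹ * M₁' s).trace - ((M₀ s)⁻¹ * M₀' s).trace| ≤ 2 * B * Real.exp (-((θ - θ₂) * R)) := by
  have h := traceDiff_le_of_summedProfiles dist h₀ h₁ hα hε hδ hβ₀ hθ₂ hθ₂θ hSdist0 (hD s hs) (hE s hs) hsep (hA s hs) (hB0 s hs) hSd hSdi (hR s hs)
  have he : 0 ≤ Real.exp (-((θ - θ₂) * R)) := (Real.exp_pos _).le
  calc |((M₁ s)⁻¹ * M₁' s).trace - ((M₀ s)⁻¹ * M₀' s).trace|
      ≤ α * ε * β₀ * δ * Sd * Sdist * Real.exp (-((θ - θ₂) * R)) + β₀ * η := h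
    _ ≤ B * Real.exp (-((θ - θ₂) * R)) + B * Real.exp (-((θ - θ₂) * R)) := add_le_add (mul_le_mul_of_nonneg_right hprod he) hmix
    _ = 2 * B * Real.exp (-((θ - θ₂) * R)) := by ring

end Summit.QuantumFields.YangMills.Theorems.FluctuationComparisonRegPrIntLS2BetaLogDetTraceDiffDoor

end
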